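import Summits.BirchSwinnertonDyer.Rank1Residual.P2.CMKolyvaginCMIsogenyAtTwoSelmer
import Summits.BirchSwinnertonDyer.BirchSwinnertonDyer.Theorems.CMKolyvaginAtInertTwoInertOrderSplittingParity
import Summits.BirchSwinnertonDyer.BirchSwinnertonDyer.Theorems.CMKolyvaginAtInertTwoInertOrderSplittingTower
import HarnessLib

/-!
# `P2` typed interface (cell `bsd-print-cf2`, seat ty2): the EXACT SELMER SPLITTING on `H₂` for EVERY
# involution moving `√Δ_E` — in particular for `Gal(L/K_H)` over the Morita tower — with NO displayed binder

Route `CMKolyvaginAtInertTwo`, crux `CMKolyvaginExactAtInertTwo` (stmt-BirchSwinnertonDyer-24277);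
MEMO `Cruxes/CMExactDescentAtTwo/MEMO-inert-order-splitting.md` §3 (a) and §5 stub S2's INPUT
«`#Sel_{2^M}(E/L) = (#Sel_{2^M}(E/L)^{σ})²` for `σ = Gal(L/K_H)`». THEOREMS ONLY (0 defs / 0 facts /
0 sorry); no item is closed; BSD is not proved by this.

cmk2-p1 g10's `InertOrderSplittingHabitat.natCard_stable_eq_sq_of_neg_sqrt` (p656982, PARITY FOR LIFTS)
gives `#S = (#S^{σ})²` for every finite `σ_*`-, `η_*`-stable `S ≤ H¹(K, E_K[2^M])` and EVERY involution `σ`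
of `K` moving a square root `r` of `Δ_E` (any lift; a `3`-cycle `z`; the equivariant CM generator `η`).
With ty2's ISOGENY generator (`CMIsogenyAtTwo.exists_cmIsogeny_selmerStable_of_cmInert_two`, p656537:
`Sel_{2^M}` is `η_*`-stable with no local-points input) and `conjAct_mem_selmerGroup` (`K` totally complex),
`S = Sel_{2^M}(E_K/K)` qualifies:

* `natCard_selmer_eq_sq_of_neg_sqrt` — on `H₂`, `K` totally complex with `√d_F ∈ K`, `σ ∈ Aut(K/ℚ)` an
  involution with `σ r = −r`, `r² = Δ_{E_K}`, `z ∈ Γ_K` fixed-point-free on `E_K[2] ∖ 0`: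
  **`#Sel_{2^M}(E_K/K) = (#Sel_{2^M}(E_K/K)^{σ})²`** for every `M` (lift := `liftAut σ`).
* `fixed_iff_exists_add_conjAct_of_neg_sqrt` — on the same data `H¹(K, E_K[2^M])^{σ} = (1 + σ_*)H¹`.
* `natCard_selmer_eq_sq_of_neg_sqrt_of_tower` — TOWER FORM with the `3`-cycle DISCHARGED
  (cmk2's `exists_fixedPointFree_two_of_tower`): `K` quadratic, `L ⊇ K` with `[L : K] = 2`, `L` totally
  complex, `√d_F ∈ L`, `σ ∈ Aut(L/ℚ)` an involution with `σ r = −r`, `r² = Δ_{E_L}` (e.g. the generator of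
  `Gal(L/K)` when `√d_F ∉ K`): **`#Sel_{2^M}(E_L/L) = (#Sel_{2^M}(E_L/L)^{σ})²`** — the input of stub S2.

beyond-print theorem: NO (Lang Ch. 10 §4 Remark; Dokchitser–Dokchitser 2012 (`ℚ(E[2]) ⊃ ℚ(√Δ)`);
Milne *ADT* I.§7). BSD is not proved by any of this; no summit statement is proved by this seat.

References: S. Lang, *Elliptic Functions* (1987), Ch. 10 §4 [Lang1987]; T. & V. Dokchitser, Math. Z. 2012
[DokchitserDokchitserMathZ2012]; J. S. Milne, *ADT* (2006), I.§7 [MilneADT2006].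
-/

set_option autoImplicit false

noncomputable section

open scoped Classical

namespace Summit.BirchSwinnertonDyer.Rank1Residual.P2.CMIsogenyAtTwo

open WeierstrassCurve Field NumberField
open Literature.NumberTheory.EllipticCurves Literature.NumberTheory.EllipticCurves.Rank1Residual
open Literature.NumberTheory.GaloisRepresentations
open Summit.BirchSwinnertonDyer.BirchSwinnertonDyer.Theorems.InertOrderSplittingHabitat

section OverK

variable (W : WeierstrassCurve ℚ) [W.IsElliptic] {K : Type} [Field K] [NumberField K]
variable {σ : K ≃ₐ[ℚ] K}

/-- **`#Sel_{2^M}(E_K/K) = (#Sel_{2^M}(E_K/K)^{σ})²` for EVERY involution `σ` of `K` moving `√Δ_E`**,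
binder-free: `E ∈ H₂` (CM, `2` inert in `F`, `ρ̄_{E,2}` onto), `K` a totally complex number field with
`√d_F ∈ K`, `σ ∈ Aut(K/ℚ)` with `σ² = 1`, `σ r = −r` for some `r` with `r² = Δ_{E_K}`, and `z ∈ Γ_K`
without non-zero fixed point on `E_K[2]`. (cmk2's `natCard_stable_eq_sq_of_neg_sqrt` for `S = Sel_{2^M}`:
`σ_*`-stable by `conjAct_mem_selmerGroup`, `η_*`-stable for the ISOGENY generator.)
[cite: Lang1987, Ch. 10 §4, Remark] [cite: DokchitserDokchitserMathZ2012, Theorem (1)] -/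
theorem natCard_selmer_eq_sq_of_neg_sqrt (hCM : W.HasCM) (hin : CMInert W 2)
    (hsurj : W.HasSurjectiveModNGaloisRep 2) (hK : ∀ w : InfinitePlace K, w.IsComplex)
    (hF : IsSquare (algebraMap ℚ K (cmFieldDiscrOfJ W.j))) (hσ : σ * σ = 1) {r : K}
    (hr : r ^ 2 = (W.baseChange K).Δ) (hσr : σ r = -r) {z : absoluteGaloisGroup K}
    (hz : ∀ P : geomPoints (W.baseChange K), (2 : ℤ) • P = 0 → z • P = P → P = 0) (M : ℕ) :
    Nat.card (selmerGroup (W.baseChange K) ((2 : ℤ) ^ M)) =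
      Nat.card {x : selmerGroup (W.baseChange K) ((2 : ℤ) ^ M) //
        conjAct W σ _ (x : galH1Torsion (W.baseChange K) ((2 : ℤ) ^ M)) = x} ^ 2 := by
  obtain ⟨k₀, c, η, hc, hrel, hη, ηn, hηnG, hηn, hSel⟩ :=
    exists_cmIsogeny_selmerStable_of_cmInert_two W hCM hin hsurj hF M
  exact natCard_stable_eq_sq_of_neg_sqrt W hσ (isLiftOfAut_liftAut σ) hr hσr (η := η.toAddMonoidHom) hrel
    hc hη hz M ηn hηn hηnG (selmerGroup (W.baseChange K) ((2 : ℤ) ^ M))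
    (fun x hx ↦ conjAct_mem_selmerGroup W hK σ _ hx) hSel

/-- **`H¹(K, E_K[2^M])^{σ} = (1 + σ_*) H¹(K, E_K[2^M])` for every involution `σ` moving `√Δ_E`**, binder-free
(cmk2's `fixed_iff_exists_add_conjAct_of_lift` with `fix_and_move_of_lift_of_neg_sqrt` and the isogeny
generator). [cite: Lang1987, Ch. 10 §4, Remark] [cite: DokchitserDokchitserMathZ2012, Theorem (1)] -/
theorem fixed_iff_exists_add_conjAct_of_neg_sqrt (hCM : W.HasCM) (hin : CMInert W 2)
    (hsurj : W.HasSurjectiveModNGaloisRep 2) (hF : IsSquare (algebraMap ℚ K (cmFieldDiscrOfJ W.j)))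
    (hσ : σ * σ = 1) {r : K} (hr : r ^ 2 = (W.baseChange K).Δ) (hσr : σ r = -r)
    {z : absoluteGaloisGroup K}
    (hz : ∀ P : geomPoints (W.baseChange K), (2 : ℤ) • P = 0 → z • P = P → P = 0) (M : ℕ)
    (x : galH1Torsion (W.baseChange K) ((2 : ℤ) ^ M)) :
    conjAct W σ _ x = x ↔ ∃ y, x = y + conjAct W σ _ y := by
  obtain ⟨k₀, c, η, hc, hrel, hη, ηn, hηnG, hηn, -⟩ :=
    exists_cmIsogeny_selmerStable_of_cmInert_two W hCM hin hsurj hF M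
  exact fixed_iff_exists_add_conjAct_of_lift W hσ (isLiftOfAut_liftAut σ) (η := η.toAddMonoidHom) hrel hc
    hη hz (fix_and_move_of_lift_of_neg_sqrt W (isLiftOfAut_liftAut σ) hr hσr).1
    (fix_and_move_of_lift_of_neg_sqrt W (isLiftOfAut_liftAut σ) hr hσr).2 M ηn hηn hηnG x

end OverK

section Tower

variable (W : WeierstrassCurve ℚ) [W.IsElliptic] {L : Type} [Field L] [NumberField L]
variable {σ : L ≃ₐ[ℚ] L}

/-- **THE INPUT OF STUB S2 — `#Sel_{2^M}(E_L/L) = (#Sel_{2^M}(E_L/L)^{σ})²` over the tower `ℚ ⊂ K ⊂ L`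
for every involution `σ ∈ Aut(L/ℚ)` moving `√Δ_E`** (e.g. the generator of `Gal(L/K)` when `√d_F ∉ K`):
`E ∈ H₂`, `K` quadratic, `[L : K] = 2`, `L` totally complex with `√d_F ∈ L`; the `3`-cycle `z ∈ Γ_L` is
cmk2's `exists_fixedPointFree_two_of_tower`. No local-points input, no lift input (`liftAut σ`).
[cite: Lang1987, Ch. 10 §4, Remark] [cite: DokchitserDokchitserMathZ2012, Theorem (1)] -/
theorem natCard_selmer_eq_sq_of_neg_sqrt_of_tower (hCM : W.HasCM) (hin : CMInert W 2)
    (hsurj : W.HasSurjectiveModNGaloisRep 2) (K : Type) [Field K] [NumberField K]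
    (hK2 : Module.finrank ℚ K = 2) [Algebra K L] (hLK : Module.finrank K L = 2)
    (hLc : ∀ w : InfinitePlace L, w.IsComplex) (hF : IsSquare (algebraMap ℚ L (cmFieldDiscrOfJ W.j)))
    (hσ : σ * σ = 1) {r : L} (hr : r ^ 2 = (W.baseChange L).Δ) (hσr : σ r = -r) (M : ℕ) :
    Nat.card (selmerGroup (W.baseChange L) ((2 : ℤ) ^ M)) =
      Nat.card {x : selmerGroup (W.baseChange L) ((2 : ℤ) ^ M) //
        conjAct W σ _ (x : galH1Torsion (W.baseChange L) ((2 : ℤ) ^ M)) = x} ^ 2 := by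
  obtain ⟨z, hz⟩ := exists_fixedPointFree_two_of_tower W K hK2 hsurj L hLK
  exact natCard_selmer_eq_sq_of_neg_sqrt W hCM hin hsurj hLc hF hσ hr hσr hz M

/-- Tower form of `H¹(L, E_L[2^M])^{σ} = (1 + σ_*) H¹(L, E_L[2^M])`, binder-free.
[cite: Lang1987, Ch. 10 §4, Remark] -/
theorem fixed_iff_exists_add_conjAct_of_neg_sqrt_of_tower (hCM : W.HasCM) (hin : CMInert W 2)
    (hsurj : W.HasSurjectiveModNGaloisRep 2) (K : Type) [Field K] [NumberField K]
    (hK2 : Module.finrank ℚ K = 2) [Algebra K L] (hLK : Module.finrank K L = 2)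
    (hF : IsSquare (algebraMap ℚ L (cmFieldDiscrOfJ W.j)))
    (hσ : σ * σ = 1) {r : L} (hr : r ^ 2 = (W.baseChange L).Δ) (hσr : σ r = -r) (M : ℕ)
    (x : galH1Torsion (W.baseChange L) ((2 : ℤ) ^ M)) :
    conjAct W σ _ x = x ↔ ∃ y, x = y + conjAct W σ _ y := by
  obtain ⟨z, hz⟩ := exists_fixedPointFree_two_of_tower W K hK2 hsurj L hLK
  exact fixed_iff_exists_add_conjAct_of_neg_sqrt W hCM hin hsurj hF hσ hr hσr hz M x

end Tower

end Summit.BirchSwinnertonDyer.Rank1Residual.P2.CMIsogenyAtTwo
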